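import Literature.AnabelianGeometry.Anabelioids.BCatBranchConjugacy
import HarnessLib

/-!
# [SemiAnbd] §2/§3: the two presentations — branch subgroups at arbitrary basepoints; aloof and
# estranged edges (Def. 2.4 (iv) p. 26)

Mochizuki, *Semi-graphs of anabelioids*, Publ. RIMS **42** (2006), Def. 2.1 pp. 23–24 ("the image
of `Π_b` in `Π_v`, which is well-defined up to conjugation in `Π_v`") and Def. 2.4 (iv) p. 26
[cite: MochizukiSemiAnbd2006, Def. 2.4(iv) p.26].  For `𝒢 : ProfiniteSemiGraph` and its §2
presentation `𝒢.toAnab`: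

* `exists_piV_mulEquiv_conj_branchSubgroup` — for EVERY basepoint `F` of `B(Π_v)` there is
  `θ : Aut F ≃* Π_v` carrying every §2 branch subgroup `Π_b^{F_e, α}` (any basepoint `F_e` of
  `B(Π_e)`, any transport `α`) to a conjugate `x · range(b_*) · x⁻¹` of the §3 branch subgroup;
* `isAloof_toAnab_of_isAloofEdge`, `isEstranged_toAnab_of_isEstrangedEdge`,
  `isTotallyAloof_toAnab`, `isTotallyEstranged_toAnab` — the §3 (one-representative, group-theoretic)
  aloofness / estrangement (`TemperedVerticial.lean`) implies the §2 one (`Commensurability.lean`,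
  as repaired by rulings Ϡ / γ2) for `𝒢.toAnab`: §2 theorems with these hypotheses apply to the
  profinite presentations of §3.

Proof-only file.
-/

noncomputable section

namespace Literature.AnabelianGeometry.SemiGraphs

open CategoryTheory CategoryTheory.Limits CategoryTheory.PreGaloisCategory
open Literature.AnabelianGeometry.Anabelioids
open Literature.AlgebraicGeometry.Frobenioids (BCat)
open scoped FintypeCatDiscrete Pointwise

universe u

/-! ### Group-theoretic transfer lemmas -/

section Transfer

variable {A B : Type*} [Group A] [Group B]

/-- `x • H = H.map (conj x)`. [folklore] -/
private theorem bridge_conjAct_smul_eq_map (x : B) (H : Subgroup B) :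
    ConjAct.toConjAct x • H = H.map (MulAut.conj x).toMonoidHom := by
  ext y
  rw [Subgroup.mem_smul_pointwise_iff_exists, Subgroup.mem_map]
  simp only [ConjAct.smul_def, ConjAct.ofConjAct_toConjAct, MulEquiv.coe_toMonoidHom,
    MulAut.conj_apply]

/-- An isomorphism carries `g • Q` to `θ g • θ(Q)`. [folklore] -/
private theorem bridge_map_conjAct_smul (θ : A ≃* B) (g : A) (Q : Subgroup A) :
    (ConjAct.toConjAct g • Q).map θ.toMonoidHom =
      ConjAct.toConjAct (θ g) • Q.map θ.toMonoidHom := by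
  rw [bridge_conjAct_smul_eq_map, bridge_conjAct_smul_eq_map, Subgroup.map_map, Subgroup.map_map]
  congr 1
  ext a
  simp [MulAut.conj_apply]

/-- Relative index is invariant under conjugation. [folklore] -/
private theorem bridge_relIndex_conjAct_smul (x : B) (H K : Subgroup B) :
    (ConjAct.toConjAct x • H).relIndex (ConjAct.toConjAct x • K) = H.relIndex K := by
  rw [bridge_conjAct_smul_eq_map, bridge_conjAct_smul_eq_map]
  exact Subgroup.relIndex_map_map_of_injective H K (MulAut.conj x).injective

/-- TRANSFER: if `θ : A ≃* B` carries `P`, `Q` to the conjugates `x • P₀`, `y • Q₀`, then the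
relative index of `P ⊓ g • Q` in `P` and its triviality are read off on `P₀`, `Q₀` with
`g' = x⁻¹ · θ g · y`. [folklore] -/
private theorem bridge_transfer (θ : A ≃* B) (P Q : Subgroup A) (P₀ Q₀ : Subgroup B) (x y : B)
    (hP : P.map θ.toMonoidHom = ConjAct.toConjAct x • P₀)
    (hQ : Q.map θ.toMonoidHom = ConjAct.toConjAct y • Q₀) (g : A) :
    (P ⊓ ConjAct.toConjAct g • Q).relIndex P =
        (Q₀.map (MulAut.conj (x⁻¹ * θ g * y)).toMonoidHom).relIndex P₀ ∧
      (P ⊓ ConjAct.toConjAct g • Q = ⊥ ↔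
        P₀ ⊓ Q₀.map (MulAut.conj (x⁻¹ * θ g * y)).toMonoidHom = ⊥) := by
  have hinj : Function.Injective θ.toMonoidHom := θ.injective
  -- the image of `P ⊓ g • Q`
  have hmul : ConjAct.toConjAct (θ g) * ConjAct.toConjAct y =
      ConjAct.toConjAct x * ConjAct.toConjAct (x⁻¹ * θ g * y) := by
    rw [← map_mul, ← map_mul, ← mul_assoc, ← mul_assoc, mul_inv_cancel, one_mul]
  have himg : (P ⊓ ConjAct.toConjAct g • Q).map θ.toMonoidHom =
      ConjAct.toConjAct x • (P₀ ⊓ ConjAct.toConjAct (x⁻¹ * θ g * y) • Q₀) := by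
    rw [Subgroup.map_inf _ _ _ hinj, bridge_map_conjAct_smul, hP, hQ, smul_smul, hmul, ← smul_smul,
      ← Subgroup.smul_inf]
  constructor
  · rw [Subgroup.inf_relIndex_left, ← Subgroup.relIndex_map_map_of_injective _ _ hinj,
      bridge_map_conjAct_smul, hQ, hP, smul_smul, hmul, ← smul_smul, bridge_relIndex_conjAct_smul,
      bridge_conjAct_smul_eq_map]
  · rw [← Subgroup.map_eq_bot_iff_of_injective _ hinj, himg,
      bridge_conjAct_smul_eq_map x (P₀ ⊓ _),
      Subgroup.map_eq_bot_iff_of_injective _ (MulAut.conj x).injective, bridge_conjAct_smul_eq_map]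

end Transfer

namespace ProfiniteSemiGraph

variable (𝒢 : ProfiniteSemiGraph.{u})

/-- **Branch subgroups at an arbitrary basepoint are conjugates of `range b_*`**: for every basepoint
`F` of `B(Π_v)` there is `θ : Aut F ≃* Π_v` such that for every branch `b` abutting to `v`, every
basepoint `F_e` of `B(Π_e)` and every transport `α : b^* ⋙ F_e ≅ F`, the §2 branch subgroup
`Π_b^{F_e,α} ⊆ Aut F` is carried to `x · range(b_*) · x⁻¹` for some `x ∈ Π_v` ("well-defined up to
conjugation in `Π_v`"). [cite: MochizukiSemiAnbd2006, Def. 2.1 pp.23-24] -/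
theorem exists_piV_mulEquiv_conj_branchSubgroup (v : 𝒢.toAnab.graph.Vertex)
    (F : 𝒢.toAnab.V v ⥤ FintypeCat.{u}) [hF : FiberFunctor F] :
    ∃ θ : 𝒢.toAnab.PiV v F ≃* 𝒢.Gv v,
      ∀ (b : 𝒢.toAnab.graph.Branch) (h : 𝒢.toAnab.graph.abuts b = some v)
        (Fe : 𝒢.toAnab.E (𝒢.toAnab.graph.edgeOf b) ⥤ FintypeCat.{u}) [FiberFunctor Fe]
        (α : (𝒢.toAnab.pull b v h).pullback ⋙ Fe ≅ F),
        ∃ x : 𝒢.Gv v, (𝒢.toAnab.branchSubgroup F b h Fe α).map θ.toMonoidHom =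
          ConjAct.toConjAct x • 𝒢.branchSubgroup b v h := by
  obtain ⟨θ, hθ⟩ := @exists_mulEquiv_forall_range_conj (𝒢.Gv v) _ _
    (𝒢.isTopologicalGroupV v) (𝒢.compactSpaceV v) (𝒢.totallyDisconnectedSpaceV v) F hF
  refine ⟨θ, fun b h Fe hFe α => ?_⟩
  obtain ⟨x, hx⟩ := @hθ (𝒢.Ge (𝒢.graph.edgeOf b)) _ _
    (𝒢.isTopologicalGroupE _) (𝒢.compactSpaceE _) (𝒢.totallyDisconnectedSpaceE _)
    (𝒢.brHom b v h) Fe hFe α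
  exact ⟨x, hx⟩

/-- **§3 aloof ⇒ §2 aloof**: if the edge `e` is aloof in the one-representative, group-theoretic
sense of `ProfiniteSemiGraph.IsAloofEdge`, then it is aloof for `𝒢.toAnab` in the sense of
`SemiGraphOfAnabelioids.IsAloof` (every basepoint, every representative).
[cite: MochizukiSemiAnbd2006, Def. 2.4(iv) p.26] -/
theorem isAloof_toAnab_of_isAloofEdge (e : 𝒢.graph.Edge) (he : 𝒢.IsAloofEdge e) :
    𝒢.toAnab.IsAloof e := by
  intro b hb v h F _ Fe _ α
  obtain ⟨θ, hθ⟩ := 𝒢.exists_piV_mulEquiv_conj_branchSubgroup v F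
  obtain ⟨x, hx⟩ := hθ b h Fe α
  constructor
  · intro b' h' Fe' _ α' g hne
    obtain ⟨y, hy⟩ := hθ b' h' Fe' α'
    rw [(bridge_transfer θ _ _ _ _ x y hx hy g).1]
    exact he b hb v h b' h' _ (Or.inl hne)
  · intro g hg
    rw [(bridge_transfer θ _ _ _ _ x x hx hx g).1]
    refine he b hb v h b h _ (Or.inr ?_)
    intro hg'
    apply hg
    have h1 : θ g ∈ (𝒢.toAnab.branchSubgroup F b h Fe α).map θ.toMonoidHom := by
      rw [hx, Subgroup.mem_pointwise_smul_iff_inv_smul_mem, ← map_inv, ConjAct.smul_def,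
        ConjAct.ofConjAct_toConjAct, inv_inv]
      exact hg'
    obtain ⟨g₀, hg₀, he0⟩ := h1
    rwa [← θ.injective he0]

/-- **§3 estranged ⇒ §2 estranged**. [cite: MochizukiSemiAnbd2006, Def. 2.4(iv) p.26] -/
theorem isEstranged_toAnab_of_isEstrangedEdge (e : 𝒢.graph.Edge) (he : 𝒢.IsEstrangedEdge e) :
    𝒢.toAnab.IsEstranged e := by
  intro b hb v h F _ Fe _ α
  obtain ⟨θ, hθ⟩ := 𝒢.exists_piV_mulEquiv_conj_branchSubgroup v F
  obtain ⟨x, hx⟩ := hθ b h Fe α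
  constructor
  · intro b' h' Fe' _ α' g hne
    obtain ⟨y, hy⟩ := hθ b' h' Fe' α'
    refine ⟨?_, ?_⟩
    · rw [(bridge_transfer θ _ _ _ _ x y hx hy g).1]
      exact he.1 b hb v h b' h' _ (Or.inl hne)
    · rw [(bridge_transfer θ _ _ _ _ x y hx hy g).2]
      exact he.2 b hb v h b' h' _ (Or.inl hne)
  · intro g hg
    have hg' : x⁻¹ * θ g * x ∉ 𝒢.branchSubgroup b v h := by
      intro hg'
      apply hg
      have h1 : θ g ∈ (𝒢.toAnab.branchSubgroup F b h Fe α).map θ.toMonoidHom := by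
        rw [hx, Subgroup.mem_pointwise_smul_iff_inv_smul_mem, ← map_inv, ConjAct.smul_def,
          ConjAct.ofConjAct_toConjAct, inv_inv]
        exact hg'
      obtain ⟨g₀, hg₀, he0⟩ := h1
      rwa [← θ.injective he0]
    refine ⟨?_, ?_⟩
    · rw [(bridge_transfer θ _ _ _ _ x x hx hx g).1]
      exact he.1 b hb v h b h _ (Or.inr hg')
    · rw [(bridge_transfer θ _ _ _ _ x x hx hx g).2]
      exact he.2 b hb v h b h _ (Or.inr hg')

/-- **§3 totally aloof ⇒ §2 totally aloof**. [cite: MochizukiSemiAnbd2006, Def. 2.4(iv) p.26] -/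
theorem isTotallyAloof_toAnab (h𝒢 : 𝒢.IsTotallyAloof) : 𝒢.toAnab.IsTotallyAloof :=
  ⟨fun e => 𝒢.isAloof_toAnab_of_isAloofEdge e (h𝒢 e)⟩

/-- **§3 totally estranged ⇒ §2 totally estranged**. [cite: MochizukiSemiAnbd2006, Def. 2.4(iv) p.26] -/
theorem isTotallyEstranged_toAnab (h𝒢 : 𝒢.IsTotallyEstranged) : 𝒢.toAnab.IsTotallyEstranged :=
  ⟨fun e => 𝒢.isEstranged_toAnab_of_isEstrangedEdge e (h𝒢 e)⟩

end ProfiniteSemiGraph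

end Literature.AnabelianGeometry.SemiGraphs

end
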